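import Summits.ABC.IUTFork.LDHGenuine
import Summits.ABC.IUTFork.LDHTensorHoffCompletions
import HarnessLib

/-!
# The fork at [IUTchIII] Corollary 3.12, L-DH level (c312-3), II-h: every local summand of the genuine `−|log(Θ)|`
# outside `T(I)` VANISHES — the per-prime form of "the truncation to `supportPrimes` loses nothing"

Record-only file (D-0012) of the abc-iut cell (Cor. 3.12 sub-crew, seat abc-iut-c312-3; plan/D9PRIME-OBLIGATIONS.md
row O3 for route D3's datum `DHData.ofInput`, abc-iut-S2); TAKES NO SIDE. Mochizuki, *IUT IV* (RIMS ms Apr. 2020),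
proof of Thm. 1.10, Step (vi), kurims p. 29 ("the “container of possible images” is precisely equal to the tensor
product of log-shells … Such an upper bound “`0`”"); Dupuy–Hilado, arXiv:2004.13228 (pre-split text) Def. 3.6.3.

abc-iut-S2's `ThetaVolumeInput.negLogThetaLoc I p` is the summand of `−|log(Θ)|` at the index `p`, defined for EVERY
`p` and summed over `T(I) = (2·|disc K|).primeFactors ∪ char(S)` only (`negLogThetaNonarch`), with the docstring
promise "at every other prime … the summand of `−|log(Θ)|` vanishes (Step (vi))". The companion file
`LDHGenuineSupport.lean` (abc-iut-S2) records the GLOBAL consequences (`negLogThetaDHOn_ofInput_eq`,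
`cor312DHLim_ofInput_iff`, from this seat's `LDHTensorHoffCompletions`). THIS FILE records the LOCAL statement itself:
* `logμ_hullUTheta_ofInput_eq_zero` — at a prime `p ∉ T(I)`, every component of `hull(U_Θ)` of `DHData.ofInput I` in a
  degree `j ≥ 1` has `log μ̄ = 0` (`LDHTensorHoffM.logμ_hullUTheta_ofIdelesM_eq_zero` over the genuine completions:
  `p > 2` and `p ∤ disc K` off `T(I)`, `CompletionLocalFieldsUnramified`);
* **`negLogThetaLoc_eq_zero_of_not_mem`** — `negLogThetaLoc I p = 0` for every prime `p ∉ T(I)`.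
[cite: Mochizuki2012, IUTchIV Thm 1.10 proof Step (vi) p.29] [cite: DupuyHilado2025, Def. 3.6.3]
[claim: Mochizuki2012, status: disputed] Nothing here concerns the truth of Cor. 3.12; the ideles of `I` remain inputs.
-/

noncomputable section

open Set Finset

namespace Summit.ABC.IUTFork

open Literature.IUT.LogVolume NumberField IsDedekindDomain

variable {F₀ : Type} [Field F₀] [NumberField F₀] {K : Type} [Field K] [NumberField K] [Algebra F₀ K]

namespace DHData

variable (I : ThetaVolumeInput F₀ K)

/-- `(2·|disc K|).primeFactors ⊆ T(I)`. [cite: Mochizuki2012, IUTchIV Thm 1.10 proof Step (vi) p.29] -/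
theorem primeFactors_subset_supportPrimes :
    (2 * (NumberField.discr K).natAbs).primeFactors ⊆ I.supportPrimes :=
  Finset.subset_union_left

/-- **Step (vi) at every summand outside `T(I)`**: for a prime `p ∉ T(I)` (so `p > 2`, `p ∤ disc K`, `p ∉ char(S)`)
and a degree `j ≥ 1`, every component of `hull(U_Θ)` of the datum of `I` has `log μ̄ = 0`.
[cite: Mochizuki2012, IUTchIV Thm 1.10 proof Step (vi) p.29] -/
theorem logμ_hullUTheta_ofInput_eq_zero {p : ℕ} [hp : Fact p.Prime] (hpT : p ∉ I.supportPrimes) {j : ℕ}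
    (hj : 1 ≤ j) (e : Fin (j + 1) → placesOver F₀ p) :
    (ofInput I).M.logμ ((ofInput I).M.hullUTheta (ofInput I).ind3 p j e) = 0 :=
  logμ_hullUTheta_ofIdelesM_eq_zero I.X I.σ.localFieldFamily I.tΘ I.tΘ_ord I.tq I.tq_ord I.supportPrimes
    (fun _ hp => I.prime_of_mem_supportPrimes hp) (fun _ hv => I.residueChar_mem_supportPrimes hv)
    I.supportPrimes (fun _ hv => I.residueChar_mem_supportPrimes hv) hpT
    (two_lt_of_not_mem_primeFactors_two_mul_discr K hp.out fun h => hpT (primeFactors_subset_supportPrimes I h))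
    (fun v => absRamificationIdx_localFieldFamily_eq_one_of_not_mem I.σ
      (fun h => hpT (primeFactors_subset_supportPrimes I h)) v)
    hj e

/-- **The truncation to `T(I)` loses nothing**: for every prime `p ∉ T(I)`, the local summand of `−|log(Θ)|`
vanishes, `negLogThetaLoc I p = 0` ("at every other prime … the summand vanishes").
[cite: Mochizuki2012, IUTchIV Thm 1.10 proof Step (vi) p.29] [cite: DupuyHilado2025, Def. 3.6.3] -/
theorem negLogThetaLoc_eq_zero_of_not_mem {p : ℕ} (hp : p.Prime) (hpT : p ∉ I.supportPrimes) :
    I.negLogThetaLoc p = 0 := by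
  rw [← lnνLp_hullUTheta_ofInput I hp]
  exact (ofInput I).lnνLp_hullUTheta_eq_zero_of_degrees (T₀ := I.supportPrimes)
    (fun q hq hqT j hj _ e => by
      haveI : Fact q.Prime := ⟨hq⟩
      exact logμ_hullUTheta_ofInput_eq_zero I hqT hj e)
    hp hpT

end DHData

end Summit.ABC.IUTFork

end
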